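import Literature.Probability.LatticeModels.CriticalTwoPointDCPLowerLemma25
import HarnessLib

/-!
# The single-current confinement inequality (crux `ExistsContinuousLimit`, stmt-CriticalPhenomena-4582,
# line `free-box-deficit`, registered stub `stub_confinement`)

For a locally finite graph `G`, a finite volume `Λ`, `β ≥ 0`, `T ⊆ Λ` and `x, y ∈ T`, granted the GKS
supermodularity `Z_{E₁}(∅) Z_{E₂}(∅) ≤ Z_{E₁∩E₂}(∅) Z_E(∅)` of sourceless current sums in the support
(hypothesis `hSM`, the neighbouring stub `stub_supermodular`),

  `Z^{xy}_{ℰ_Λ}[C_n(y) ⊆ T] · Z^∅_{ℰ_T} ≤ Z^{xy}_{ℰ_T} · Z^∅_{ℰ_Λ}`,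

i.e. `⟨σₓσ_y⟩_Λ · P^{xy}_Λ[C_n(y) ⊆ T] ≤ ⟨σₓσ_y⟩^free_T` (un-normalised current form; all sums in `ℝ≥0∞`).

## Proof

Decompose both sourced sums according to the value `K` of the cluster complement
`𝒮_y(n) = clusterCompl G Λ n y` (`confinement_tsum_decompose`). For `K ⊆ Λ` with `x, y ∉ K` and `Λ ∖ K ⊆ T`
the event `𝒮_y(n) = K` is "no charge across the cut `(Λ ∖ K, K)`" times an event of the inner part
`n^{ℰ_{Λ∖K}}` (`clusterCompl_eq_iff`, `cconn_crestr_iff`), so the bijection `n ↦ (n^{ℰ_{Λ∖K}}, n^{ℰ_K})`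
(`IsFoldable.tsum_cut_factor`) gives
`Z^{xy}_{ℰ_Λ}[𝒮_y = K] = I(K) · Z_{ℰ_K}(∅)` and `Z^{xy}_{ℰ_T}[𝒮_y = K] = I(K) · Z_{ℰ_K ∩ ℰ_T}(∅)` with the same
inner factor `I(K)`; supermodularity at `E₁ = ℰ_K`, `E₂ = ℰ_T`, `E = ℰ_Λ` concludes termwise
(`confinement_term_le`). For the other `K` the left term vanishes (`y ∉ 𝒮_y(n)`; `x ⟷ y` by the handshake
`cconn_of_csources_eq`; the cluster `Λ ∖ K` lies in `T` on the event). [folklore]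
-/

noncomputable section

namespace Summit.CriticalPhenomena.Ising3DConformalLimit.ReflectionTwinExistsContinuousLimit.FreeBox

open Finset Filter
open scoped BigOperators symmDiff ENNReal Topology
open Literature.Probability.LatticeModels
open Classical

/-- Decomposition of a current sum according to the value of the cluster complement `𝒮_b(n)`:
`∑_n F(n) = ∑_{K ⊆ Λ} ∑_n F(n) 𝟙[𝒮_b(n) = K]`. [folklore] -/
theorem confinement_tsum_decompose {V : Type*} [DecidableEq V] (G : SimpleGraph V) [G.LocallyFinite]
    (Λ : Finset V) (b : V) (F : (edgesIn G Λ → ℕ) → ℝ≥0∞) :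
    ∑' n, F n = ∑ K ∈ Λ.powerset, ∑' n, F n * ind (clusterCompl G Λ n b = K) := by
  have hpt : ∀ n : edgesIn G Λ → ℕ, F n = ∑ K ∈ Λ.powerset, F n * ind (clusterCompl G Λ n b = K) :=
    fun n => by rw [← mul_sum, sum_ind_clusterCompl_eq, mul_one]
  rw [← Summable.tsum_finsetSum (fun _ _ => ENNReal.summable)]
  exact tsum_congr hpt

/-- A source of a current with sources `{x} ∆ {y}` is connected to `y`: `x ∉ 𝒮_y(n)` (handshake). [folklore] -/
theorem confinement_not_mem_clusterCompl {V : Type*} [DecidableEq V] {G : SimpleGraph V} [G.LocallyFinite]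
    {Λ : Finset V} {n : edgesIn G Λ → ℕ} {x y : V} (hsrc : csources G Λ n = {x} ∆ {y}) :
    x ∉ clusterCompl G Λ n y := by
  by_cases hxy : x = y
  · rw [hxy]
    exact not_mem_clusterCompl_self n y
  · intro hmem
    exact (mem_clusterCompl.1 hmem).2 (cconn_of_csources_eq hxy hsrc).symm

/-- Supports intersect: `n ⊆ E₁ ∩ E₂` iff `n ⊆ E₁` and `n ⊆ E₂`. [folklore] -/
theorem confinement_csupp_inter_iff {V : Type*} [DecidableEq V] {G : SimpleGraph V} [G.LocallyFinite]
    {Λ : Finset V} (E₁ E₂ : Finset (Sym2 V)) (n : edgesIn G Λ → ℕ) :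
    CSupp G Λ (E₁ ∩ E₂) n ↔ CSupp G Λ E₁ n ∧ CSupp G Λ E₂ n :=
  ⟨fun h => ⟨fun e he => (mem_inter.1 (h e he)).1, fun e he => (mem_inter.1 (h e he)).2⟩,
    fun h e he => mem_inter.2 ⟨h.1 e he, h.2 e he⟩⟩

/-- **The termwise confinement inequality.** For `K ⊆ Λ`, with `𝒮_y(n)` the cluster complement of `y`,
`Z^{xy}_{ℰ_Λ}[C_n(y) ⊆ T, 𝒮_y = K] · Z^∅_{ℰ_T} ≤ Z^{xy}_{ℰ_T}[𝒮_y = K] · Z^∅_{ℰ_Λ}` (cut factorisation along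
`(Λ ∖ K, K)` and supermodularity at `ℰ_K, ℰ_T ⊆ ℰ_Λ`). [folklore] -/
theorem confinement_term_le {V : Type*} [DecidableEq V] (G : SimpleGraph V) [G.LocallyFinite] (Λ : Finset V)
    {β : ℝ}
    (hSM : ∀ (E₁ E₂ E : Finset (Sym2 V)), E₁ ⊆ E → E₂ ⊆ E → E ⊆ edgesIn G Λ →
      currentZ G Λ β E₁ ∅ * currentZ G Λ β E₂ ∅ ≤ currentZ G Λ β (E₁ ∩ E₂) ∅ * currentZ G Λ β E ∅)
    {T : Finset V} (hT : T ⊆ Λ) {x y : V} (hx : x ∈ T) (hy : y ∈ T) {K : Finset V} (hK : K ⊆ Λ) :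
    (∑' n : edgesIn G Λ → ℕ,
        ind (csources G Λ n = {x} ∆ {y} ∧ CSupp G Λ (edgesIn G Λ) n ∧ ∀ v, CConn G Λ n (edgesIn G Λ) y v → v ∈ T) *
          cweight G Λ β n * ind (clusterCompl G Λ n y = K)) *
      currentZ G Λ β (edgesIn G T) ∅ ≤
    (∑' n : edgesIn G Λ → ℕ,
        ind (csources G Λ n = {x} ∆ {y} ∧ CSupp G Λ (edgesIn G T) n) * cweight G Λ β n *
          ind (clusterCompl G Λ n y = K)) *
      currentZ G Λ β (edgesIn G Λ) ∅ := by
  by_cases hgood : x ∉ K ∧ y ∉ K ∧ Λ \ K ⊆ T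
  · obtain ⟨hxK, hyK, hCT⟩ := hgood
    -- the cluster side `C = Λ ∖ K` carries the sources
    set C : Finset V := Λ \ K with hC
    have hKC : Λ \ C = K := Finset.sdiff_sdiff_eq_self hK
    have hyC : y ∈ Λ \ K := mem_sdiff.2 ⟨hT hy, hyK⟩
    have hA : ({x} ∆ {y} : Finset V) ⊆ C := by
      intro v hv
      rw [mem_symmDiff, mem_singleton, mem_singleton] at hv
      rcases hv with ⟨rfl, -⟩ | ⟨rfl, -⟩
      · exact mem_sdiff.2 ⟨hT hx, hxK⟩
      · exact hyC
    have hdisj : Disjoint (edgesIn G C) (edgesIn G K) := by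
      have := disjoint_edgesIn_sdiff (G := G) (Λ := Λ) C
      rwa [hKC] at this
    -- the inner event and the inner factor `I(K)`
    set Inner : (edgesIn G Λ → ℕ) → Prop := fun m => ∀ v ∈ C, CConn G Λ m (edgesIn G C) y v with hInner
    -- characterisation of `𝒮_y(n) = K` across the cut `(C, K)`
    have hchar : ∀ n : edgesIn G Λ → ℕ, clusterCompl G Λ n y = K ↔
        CSupp G Λ (edgesIn G C ∪ edgesIn G K) n ∧ Inner (crestr G Λ (edgesIn G C) n) := by
      intro n
      rw [clusterCompl_eq_iff hK hyC, union_comm]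
      refine and_congr Iff.rfl ⟨fun h v hv => ?_, fun h v hv => ?_⟩
      · exact cconn_crestr_iff.2 (h v hv)
      · exact cconn_crestr_iff.1 (h v hv)
    -- the cut factorisation, with `Λ ∖ C = K`
    have hfac : ∀ F₁ F₂ : (edgesIn G Λ → ℕ) → ℝ≥0∞,
        ∑' n, ind (csources G Λ n = {x} ∆ {y} ∧ CSupp G Λ (edgesIn G Λ) n) * cweight G Λ β n *
            (ind (CSupp G Λ (edgesIn G C ∪ edgesIn G K) n) *
              (F₁ (crestr G Λ (edgesIn G C) n) * F₂ (crestr G Λ (edgesIn G K) n))) =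
          (∑' n₁, ind (csources G Λ n₁ = {x} ∆ {y} ∧ CSupp G Λ (edgesIn G C) n₁) * cweight G Λ β n₁ * F₁ n₁) *
            ∑' n₂, ind (csources G Λ n₂ = ∅ ∧ CSupp G Λ (edgesIn G K) n₂) * cweight G Λ β n₂ * F₂ n₂ := by
      have h := IsFoldable.tsum_cut_factor (G := G) (Λ := Λ) β hA
      rw [hKC] at h
      exact h
    -- left: drop the confinement event, then factorise
    have hL : ∑' n : edgesIn G Λ → ℕ,
        ind (csources G Λ n = {x} ∆ {y} ∧ CSupp G Λ (edgesIn G Λ) n ∧ ∀ v, CConn G Λ n (edgesIn G Λ) y v → v ∈ T) *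
          cweight G Λ β n * ind (clusterCompl G Λ n y = K) ≤
        (∑' n₁, ind (csources G Λ n₁ = {x} ∆ {y} ∧ CSupp G Λ (edgesIn G C) n₁) * cweight G Λ β n₁ *
            ind (Inner n₁)) * currentZ G Λ β (edgesIn G K) ∅ := by
      calc ∑' n : edgesIn G Λ → ℕ,
            ind (csources G Λ n = {x} ∆ {y} ∧ CSupp G Λ (edgesIn G Λ) n ∧
                ∀ v, CConn G Λ n (edgesIn G Λ) y v → v ∈ T) *
              cweight G Λ β n * ind (clusterCompl G Λ n y = K)
          ≤ ∑' n : edgesIn G Λ → ℕ, ind (csources G Λ n = {x} ∆ {y} ∧ CSupp G Λ (edgesIn G Λ) n) *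
              cweight G Λ β n * (ind (CSupp G Λ (edgesIn G C ∪ edgesIn G K) n) *
                (ind (Inner (crestr G Λ (edgesIn G C) n)) * (fun _ => (1 : ℝ≥0∞)) (crestr G Λ (edgesIn G K) n))) := by
            refine ENNReal.tsum_le_tsum fun n => ?_
            rw [mul_one, ← ind_and, ← ind_congr (hchar n)]
            gcongr
            exact ind_mono fun h => ⟨h.1, h.2.1⟩
        _ = _ := by
            rw [hfac (fun m => ind (Inner m)) (fun _ => 1)]
            unfold currentZ
            simp only [mul_one]
    -- right: factorise (the `ℰ_T`-support reads on the outer part since `ℰ_C ⊆ ℰ_T`)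
    have hCT' : edgesIn G C ⊆ edgesIn G T := edgesIn_mono G hCT
    have hR : ∑' n : edgesIn G Λ → ℕ,
        ind (csources G Λ n = {x} ∆ {y} ∧ CSupp G Λ (edgesIn G T) n) * cweight G Λ β n *
          ind (clusterCompl G Λ n y = K) =
        (∑' n₁, ind (csources G Λ n₁ = {x} ∆ {y} ∧ CSupp G Λ (edgesIn G C) n₁) * cweight G Λ β n₁ *
            ind (Inner n₁)) * currentZ G Λ β (edgesIn G K ∩ edgesIn G T) ∅ := by
      calc ∑' n : edgesIn G Λ → ℕ,
            ind (csources G Λ n = {x} ∆ {y} ∧ CSupp G Λ (edgesIn G T) n) * cweight G Λ β n *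
              ind (clusterCompl G Λ n y = K)
          = ∑' n : edgesIn G Λ → ℕ, ind (csources G Λ n = {x} ∆ {y} ∧ CSupp G Λ (edgesIn G Λ) n) *
              cweight G Λ β n * (ind (CSupp G Λ (edgesIn G C ∪ edgesIn G K) n) *
                (ind (Inner (crestr G Λ (edgesIn G C) n)) *
                  ind (CSupp G Λ (edgesIn G T) (crestr G Λ (edgesIn G K) n)))) := by
            refine tsum_congr fun n => ?_
            by_cases hcut : CSupp G Λ (edgesIn G C ∪ edgesIn G K) n
            · have hTiff : CSupp G Λ (edgesIn G T) n ↔ CSupp G Λ (edgesIn G T) (crestr G Λ (edgesIn G K) n) := by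
                constructor
                · intro h e he
                  refine h e fun h0 => he ?_
                  by_cases heK : (e : Sym2 V) ∈ edgesIn G K
                  · rw [crestr_apply_of_mem n heK, h0]
                  · exact crestr_apply_of_not_mem n heK
                · intro h e he
                  rcases mem_union.1 (hcut e he) with heC | heK
                  · exact hCT' heC
                  · exact h e (by rwa [crestr_apply_of_mem n heK])
              have hcc : ind (clusterCompl G Λ n y = K) = ind (Inner (crestr G Λ (edgesIn G C) n)) := by
                refine ind_congr ?_
                rw [hchar n]
                exact ⟨fun h => h.2, fun h => ⟨hcut, h⟩⟩
              rw [ind_of_true hcut, one_mul, hcc, ← ind_congr hTiff,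
                show ind (csources G Λ n = {x} ∆ {y} ∧ CSupp G Λ (edgesIn G T) n) =
                    ind (csources G Λ n = {x} ∆ {y} ∧ CSupp G Λ (edgesIn G Λ) n) * ind (CSupp G Λ (edgesIn G T) n) from by
                  rw [← ind_and]
                  exact ind_congr ⟨fun h => ⟨⟨h.1, csupp_edgesIn n⟩, h.2⟩, fun h => ⟨h.1.1, h.2⟩⟩]
              ring
            · have hcc : ind (clusterCompl G Λ n y = K) = 0 := ind_of_false fun h => hcut ((hchar n).1 h).1
              rw [hcc, ind_of_false hcut]
              simp
        _ = _ := by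
            rw [hfac (fun m => ind (Inner m)) (fun m => ind (CSupp G Λ (edgesIn G T) m))]
            congr 1
            unfold currentZ
            refine tsum_congr fun n₂ => ?_
            rw [mul_assoc, mul_comm (cweight G Λ β n₂), ← mul_assoc, ← ind_and]
            congr 1
            refine ind_congr ?_
            rw [confinement_csupp_inter_iff]
            tauto
    -- supermodularity termwise
    have hsm := hSM (edgesIn G K) (edgesIn G T) (edgesIn G Λ) (edgesIn_mono G hK) (edgesIn_mono G hT) Subset.rfl
    calc _ ≤ (∑' n₁, ind (csources G Λ n₁ = {x} ∆ {y} ∧ CSupp G Λ (edgesIn G C) n₁) * cweight G Λ β n₁ *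
            ind (Inner n₁)) * currentZ G Λ β (edgesIn G K) ∅ * currentZ G Λ β (edgesIn G T) ∅ := by
          gcongr
      _ = (∑' n₁, ind (csources G Λ n₁ = {x} ∆ {y} ∧ CSupp G Λ (edgesIn G C) n₁) * cweight G Λ β n₁ *
            ind (Inner n₁)) * (currentZ G Λ β (edgesIn G K) ∅ * currentZ G Λ β (edgesIn G T) ∅) := by
          rw [mul_assoc]
      _ ≤ (∑' n₁, ind (csources G Λ n₁ = {x} ∆ {y} ∧ CSupp G Λ (edgesIn G C) n₁) * cweight G Λ β n₁ *
            ind (Inner n₁)) * (currentZ G Λ β (edgesIn G K ∩ edgesIn G T) ∅ * currentZ G Λ β (edgesIn G Λ) ∅) := by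
          gcongr
      _ = _ := by rw [← mul_assoc, ← hR]
  · -- degenerate `K`: the left sum vanishes
    have h0 : ∑' n : edgesIn G Λ → ℕ,
        ind (csources G Λ n = {x} ∆ {y} ∧ CSupp G Λ (edgesIn G Λ) n ∧ ∀ v, CConn G Λ n (edgesIn G Λ) y v → v ∈ T) *
          cweight G Λ β n * ind (clusterCompl G Λ n y = K) = 0 := by
      refine ENNReal.tsum_eq_zero.2 fun n => ?_
      by_cases hev : csources G Λ n = {x} ∆ {y} ∧ CSupp G Λ (edgesIn G Λ) n ∧
          ∀ v, CConn G Λ n (edgesIn G Λ) y v → v ∈ T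
      · rw [ind_of_false (show ¬ clusterCompl G Λ n y = K from fun hcc => hgood ?_), mul_zero]
        refine ⟨hcc ▸ confinement_not_mem_clusterCompl hev.1, hcc ▸ not_mem_clusterCompl_self n y,
          fun v hv => hev.2.2 v ?_⟩
        obtain ⟨hvΛ, hvK⟩ := mem_sdiff.1 hv
        by_contra hnc
        exact hvK (hcc ▸ mem_clusterCompl.2 ⟨hvΛ, hnc⟩)
      · rw [ind_of_false hev, zero_mul, zero_mul]
    rw [h0, zero_mul]
    exact bot_le

/-- **Stub 2 — the confinement inequality** (cluster decomposition of the sourced current along `C_n(y)`, then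
supermodularity termwise): granted supermodularity on `(G, Λ)`, for `T ⊆ Λ`, `x, y ∈ T`,
`Z^{xy}_{ℰ_Λ}[C_n(y) ⊆ T] · Z^∅_{ℰ_T} ≤ Z^{xy}_{ℰ_T} · Z^∅_{ℰ_Λ}`, i.e. `⟨σₓσ_y⟩_Λ P^{xy}_Λ[C_n(y) ⊆ T] ≤ ⟨σₓσ_y⟩^free_T`. [folklore] -/
theorem stub_confinement {V : Type*} [DecidableEq V] (G : SimpleGraph V) [G.LocallyFinite] (Λ : Finset V)
    {β : ℝ} (hβ : 0 ≤ β)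
    (hSM : ∀ (E₁ E₂ E : Finset (Sym2 V)), E₁ ⊆ E → E₂ ⊆ E → E ⊆ edgesIn G Λ →
      currentZ G Λ β E₁ ∅ * currentZ G Λ β E₂ ∅ ≤ currentZ G Λ β (E₁ ∩ E₂) ∅ * currentZ G Λ β E ∅)
    (T : Finset V) (hT : T ⊆ Λ) (x y : V) (hx : x ∈ T) (hy : y ∈ T) :
    (∑' n : edgesIn G Λ → ℕ,
        ind (csources G Λ n = {x} ∆ {y} ∧ CSupp G Λ (edgesIn G Λ) n ∧ ∀ v, CConn G Λ n (edgesIn G Λ) y v → v ∈ T) *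
          cweight G Λ β n) *
      currentZ G Λ β (edgesIn G T) ∅ ≤
    currentZ G Λ β (edgesIn G T) ({x} ∆ {y}) * currentZ G Λ β (edgesIn G Λ) ∅ := by
  have _ := hβ
  rw [confinement_tsum_decompose G Λ y (fun n => ind (csources G Λ n = {x} ∆ {y} ∧ CSupp G Λ (edgesIn G Λ) n ∧
      ∀ v, CConn G Λ n (edgesIn G Λ) y v → v ∈ T) * cweight G Λ β n),
    show currentZ G Λ β (edgesIn G T) ({x} ∆ {y}) =
        ∑' n : edgesIn G Λ → ℕ, ind (csources G Λ n = {x} ∆ {y} ∧ CSupp G Λ (edgesIn G T) n) * cweight G Λ β n from rfl,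
    confinement_tsum_decompose G Λ y (fun n => ind (csources G Λ n = {x} ∆ {y} ∧ CSupp G Λ (edgesIn G T) n) *
      cweight G Λ β n),
    sum_mul, sum_mul]
  exact sum_le_sum fun K hK => confinement_term_le G Λ hSM hT hx hy (mem_powerset.1 hK)

end Summit.CriticalPhenomena.Ising3DConformalLimit.ReflectionTwinExistsContinuousLimit.FreeBox
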